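import Mathlib
import Summits.MatrixMultiplication.MatrixMultiplication.Theorems.AutomaticSTPPDesignsAutomaticPackingThesisUniformNormalForm

/-!
# `AutomaticPackingThesis` — prime hosts, uniform blocks (the sharpest normal form)

Route `MatrixMultiplication/AutomaticSTPPDesigns`, crux `stmt-MatrixMultiplication-7356`
(`AutomaticPackingThesis`), line `Sketch` (lead c2, cycle 3), registered stub
`stub_primeUniformNormalForm`. Support file (`--supports`).

`automaticPackingThesis_iff_primeUniformBeat`: the crux holds iff for every `τ > 2/3` some PRIME
cyclic group `ℤ/q` hosts an STPP design all of whose blocks have one size `M ≥ 2` with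
`q < n · (M³)^τ`. So a refutation may assume a prime host (no subgroups, no Chinese-remainder or
digit structure inside the host; Cauchy–Davenport and prime-field Fourier analysis available) and
uniform blocks, and a construction may use any modulus and any block profile.

Proof of `→`: a uniform witness in `ℤ/(p^K)` (`uniformBeat_of_cyclicBeat`) has uniform concatenation
powers (`stub_powFamily`: blocks of size `M^m`) of ratio `r^m > 6`; the map `x ↦ x.val` into `ℤ/q`
for a prime `q ∈ (3N, 6N]` (Bertrand) preserves the STPP — a six-term relation of representatives
has absolute value `< 3N < q`, so it vanishes in `ℤ/q` only if it vanishes in `ℤ`, hence in `ℤ/N` —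
and the block sizes, while `q ≤ 6N <` the packing sum (`isSTPP_transfer_val`).

## References

* H. Cohn, R. Kleinberg, B. Szegedy, C. Umans, *Group-theoretic algorithms for matrix
  multiplication*, FOCS 2005, arXiv:math/0511460: Def. 5.1, Lemma 5.4, Thm. 5.5.
-/

-- single-conjunct summit: the mandated namespace repeats `MatrixMultiplication`.
set_option linter.dupNamespace false

noncomputable section

namespace Summit.MatrixMultiplication.MatrixMultiplication.Theorems

namespace AutomaticPackingThesis

open Finset Literature.Combinatorics.Additive Literature.Computability.AlgebraicComplexity
open Summit.MatrixMultiplication.MatrixMultiplication.Theses.AutomaticSTPPDesigns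

/-! ### Transfer to a larger modulus along representatives -/

/-- **Re-hosting along representatives.** An STPP design in `ℤ/N` (`N ≥ 1`) maps to an STPP design
with the same block sizes in `ℤ/P` for every `P > 3(N-1)` (in particular every `P ≥ 3N`) under
`x ↦ x.val`: a six-term STPP relation between representatives in `[0, N)` has absolute value
`≤ 3(N-1) < P`, so if it vanishes modulo `P` it vanishes in `ℤ`, hence modulo `N`. [folklore] -/
theorem isSTPP_transfer_val {N P n : ℕ} [NeZero N] (hP : 3 * N ≤ P + 2)
    {A B C : Fin n → Finset (ZMod N)} (hS : IsSTPP A B C) :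
    IsSTPP (fun i => (A i).image fun x : ZMod N => ((x.val : ℕ) : ZMod P))
      (fun i => (B i).image fun x : ZMod N => ((x.val : ℕ) : ZMod P))
      (fun i => (C i).image fun x : ZMod N => ((x.val : ℕ) : ZMod P)) ∧
    ∀ i, ((A i).image fun x : ZMod N => ((x.val : ℕ) : ZMod P)).card = (A i).card ∧
      ((B i).image fun x : ZMod N => ((x.val : ℕ) : ZMod P)).card = (B i).card ∧
      ((C i).image fun x : ZMod N => ((x.val : ℕ) : ZMod P)).card = (C i).card := by
  have hN : 0 < N := Nat.pos_of_ne_zero (NeZero.ne N)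
  -- the map is injective (`N ≤ P` for `N ≥ 1`)
  have hNP : N ≤ P := by omega
  set φ : ZMod N → ZMod P := fun x => ((x.val : ℕ) : ZMod P) with hφ
  have hφinj : Function.Injective φ := by
    intro x y hxy
    have hx : x.val < P := x.val_lt.trans_le hNP
    have hy : y.val < P := y.val_lt.trans_le hNP
    have h := congrArg ZMod.val hxy
    haveI : NeZero P := ⟨by omega⟩
    simp only [hφ, ZMod.val_natCast_of_lt hx, ZMod.val_natCast_of_lt hy] at h
    exact ZMod.val_injective _ h
  refine ⟨?_, fun i => ⟨card_image_of_injective _ hφinj, card_image_of_injective _ hφinj,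
    card_image_of_injective _ hφinj⟩⟩
  intro i j k s hs s' hs' t ht t' ht' u hu u' hu' hrel
  simp only [mem_image] at hs hs' ht ht' hu hu'
  obtain ⟨s₀, hs₀, rfl⟩ := hs
  obtain ⟨s₀', hs₀', rfl⟩ := hs'
  obtain ⟨t₀, ht₀, rfl⟩ := ht
  obtain ⟨t₀', ht₀', rfl⟩ := ht'
  obtain ⟨u₀, hu₀, rfl⟩ := hu
  obtain ⟨u₀', hu₀', rfl⟩ := hu'
  -- the relation as an integer
  set r : ℤ := ((s₀'.val : ℤ) - s₀.val) + ((t₀'.val : ℤ) - t₀.val) + ((u₀'.val : ℤ) - u₀.val)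
    with hr
  have hrP : ((r : ℤ) : ZMod P) = 0 := by
    rw [hr]
    push_cast
    exact hrel
  have hrabs : |r| < P := by
    have h1 := s₀.val_lt; have h2 := s₀'.val_lt; have h3 := t₀.val_lt
    have h4 := t₀'.val_lt; have h5 := u₀.val_lt; have h6 := u₀'.val_lt
    rw [abs_lt]
    constructor <;> omega
  have hr0 : r = 0 := by
    rw [ZMod.intCast_zmod_eq_zero_iff_dvd] at hrP
    exact Int.eq_zero_of_abs_lt_dvd hrP hrabs
  -- hence the relation holds in `ℤ/N`
  have hrelN : (s₀' - s₀) + (t₀' - t₀) + (u₀' - u₀) = (0 : ZMod N) := by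
    have hc : ((r : ℤ) : ZMod N) = 0 := by rw [hr0, Int.cast_zero]
    rw [hr] at hc
    push_cast at hc
    simpa only [ZMod.natCast_val, ZMod.cast_id', id] using hc
  obtain ⟨hij, hjk, h1, h2, h3⟩ := hS i j k s₀ hs₀ s₀' hs₀' t₀ ht₀ t₀' ht₀' u₀ hu₀ u₀' hu₀' hrelN
  exact ⟨hij, hjk, by rw [h1], by rw [h2], by rw [h3]⟩

/-! ### Uniform powers and prime hosts -/

/-- **Uniform designs power up uniformly**: a uniform STPP design (`n` triples of `M`-blocks) in
`ℤ/(p^K)` beating its host with ratio `r > 1` at exponent `τ` has, for every bound `R`, a uniform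
concatenation power (blocks of size `M^m`, `stub_powFamily`) whose packing sum exceeds `R` times
its host. [folklore] -/
theorem exists_uniform_ratio (p K n M : ℕ) (hp : 0 < p) (A B C : Fin n → Finset (ZMod (p ^ K)))
    (hS : IsSTPP A B C) (hcard : ∀ i, (A i).card = M ∧ (B i).card = M ∧ (C i).card = M)
    (τ R : ℝ) (hbeat : (p : ℝ) ^ K < n * ((M : ℝ) ^ 3) ^ τ) :
    ∃ (K' n' M' : ℕ) (A' B' C' : Fin n' → Finset (ZMod (p ^ K'))), IsSTPP A' B' C' ∧
      (∀ i, (A' i).card = M' ∧ (B' i).card = M' ∧ (C' i).card = M') ∧ M ≤ M' ∧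
        R * (p : ℝ) ^ K' < n' * ((M' : ℝ) ^ 3) ^ τ := by
  classical
  set P : ℝ := (p : ℝ) ^ K with hP
  set S : ℝ := n * ((M : ℝ) ^ 3) ^ τ with hSdef
  have hP0 : 0 < P := by positivity
  have hr : 1 < S / P := by rwa [one_lt_div hP0]
  obtain ⟨m, hm⟩ := pow_unbounded_of_one_lt R hr
  -- use the `(m+1)`-st power so that `M ≤ M^(m+1)`
  obtain ⟨Am, Bm, Cm, hSm, hcm⟩ := stub_powFamily p K n hp A B C hS (m + 1)
  set e : Fin (Fintype.card (Fin (m + 1) → Fin n)) ≃ (Fin (m + 1) → Fin n) :=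
    (Fintype.equivFin _).symm with he
  refine ⟨K * (m + 1), Fintype.card (Fin (m + 1) → Fin n), M ^ (m + 1), Am ∘ e, Bm ∘ e, Cm ∘ e,
    (isSTPP_iff_addSimultaneousTPP _ _ _).2 (hSm.comp e.injective), ?_,
    Nat.le_self_pow (by omega) M, ?_⟩
  · intro i
    obtain ⟨h1, h2, h3⟩ := hcm (e i)
    simp only [Function.comp_apply, h1, h2, h3, (hcard _).1, (hcard _).2.1, (hcard _).2.2,
      prod_const, card_univ, Fintype.card_fin, and_self]
  · -- packing sum `= S^(m+1) = (S/P)^(m+1) P^(m+1) > R P^(m+1)`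
    have hM3 : (((M ^ (m + 1) : ℕ) : ℝ) ^ 3) ^ τ = (((M : ℝ) ^ 3) ^ τ) ^ (m + 1) := by
      push_cast
      rw [← pow_mul, mul_comm (m + 1) 3, pow_mul]
      exact (Real.rpow_pow_comm (by positivity) τ (m + 1)).symm
    rw [Fintype.card_fun, Fintype.card_fin, Fintype.card_fin, hM3]
    push_cast
    have hSm1 : (n : ℝ) ^ (m + 1) * (((M : ℝ) ^ 3) ^ τ) ^ (m + 1) = S ^ (m + 1) := by
      rw [hSdef, mul_pow]
    rw [hSm1, pow_mul]
    have hSm : S ^ (m + 1) = (S / P) ^ (m + 1) * P ^ (m + 1) := by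
      rw [div_pow, div_mul_cancel₀ _ (pow_ne_zero _ hP0.ne')]
    rw [hSm, pow_succ (S / P)]
    have hPm : 0 < P ^ (m + 1) := pow_pos hP0 _
    have h1 : R < (S / P) ^ m * (S / P) := by
      have := hr.le
      nlinarith [pow_pos (lt_trans one_pos hr) m]
    exact mul_lt_mul_of_pos_right h1 hPm

/-- **Prime hosts, uniform blocks.** For `τ > 2/3`, a finite cyclic STPP design beating its host at
exponent `τ` yields one in a PRIME cyclic group `ℤ/q` all of whose blocks have one size `M ≥ 2`,
with `q < n · (M³)^τ` (uniformise, power up to ratio `> 6`, re-host along representatives in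
`ℤ/q` for a prime `q ∈ (3N, 6N]`). [folklore] -/
theorem primeUniformBeat_of_cyclicBeat {τ : ℝ} (hτ : 2 / 3 < τ)
    (h : ∃ (p K n : ℕ) (_ : 2 ≤ p) (A B C : Fin n → Finset (ZMod (p ^ K))),
      IsSTPP A B C ∧ (p : ℝ) ^ K < ∑ i, (((A i).card * (B i).card * (C i).card : ℕ) : ℝ) ^ τ) :
    ∃ (q n M : ℕ) (_ : q.Prime) (_ : 2 ≤ M) (A B C : Fin n → Finset (ZMod q)),
      IsSTPP A B C ∧ (∀ i, (A i).card = M ∧ (B i).card = M ∧ (C i).card = M) ∧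
        (q : ℝ) < n * ((M : ℝ) ^ 3) ^ τ := by
  obtain ⟨p, K, n, M, hp, hM, A, B, C, hS, hcard, hbeat⟩ := uniformBeat_of_cyclicBeat hτ h
  have hp0 : 0 < p := by omega
  obtain ⟨K', n', M', A', B', C', hS', hcard', hMM', hbeat'⟩ :=
    exists_uniform_ratio p K n M hp0 A B C hS hcard τ 6 hbeat
  -- a prime `q` with `3 p^K' < q ≤ 6 p^K'`
  haveI : NeZero (p ^ K') := ⟨pow_ne_zero _ hp0.ne'⟩
  have hN0 : 3 * p ^ K' ≠ 0 := by positivity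
  obtain ⟨q, hq, hltq, hqle⟩ := Nat.exists_prime_lt_and_le_two_mul (3 * p ^ K') hN0
  obtain ⟨hSq, hcq⟩ := isSTPP_transfer_val (N := p ^ K') (P := q) (by omega) hS'
  have hM2 : 2 ≤ M' := hM.trans hMM'
  refine ⟨q, n', M', hq, hM2, _, _, _, hSq, fun i => ?_, ?_⟩
  · obtain ⟨h1, h2, h3⟩ := hcq i
    rw [h1, h2, h3]
    exact hcard' i
  · have hq6 : (q : ℝ) ≤ 6 * (p : ℝ) ^ K' := by
      have : (q : ℝ) ≤ ((2 * (3 * p ^ K') : ℕ) : ℝ) := by exact_mod_cast hqle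
      push_cast at this
      linarith
    exact hq6.trans_lt hbeat'

/-- A prime uniform witness is in particular a witness of the any-modulus normal form. [folklore] -/
theorem anyModulusBeat_of_primeUniformBeat {τ : ℝ}
    (h : ∃ (q n M : ℕ) (_ : q.Prime) (_ : 2 ≤ M) (A B C : Fin n → Finset (ZMod q)),
      IsSTPP A B C ∧ (∀ i, (A i).card = M ∧ (B i).card = M ∧ (C i).card = M) ∧
        (q : ℝ) < n * ((M : ℝ) ^ 3) ^ τ) :
    ∃ (N n : ℕ) (_ : 2 ≤ N) (A B C : Fin n → Finset (ZMod N)),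
      IsSTPP A B C ∧ (N : ℝ) < ∑ i, (((A i).card * (B i).card * (C i).card : ℕ) : ℝ) ^ τ := by
  obtain ⟨q, n, M, hq, -, A, B, C, hS, hcard, hbeat⟩ := h
  refine ⟨q, n, hq.two_le, A, B, C, hS, ?_⟩
  have hsum : ∑ i, (((A i).card * (B i).card * (C i).card : ℕ) : ℝ) ^ τ =
      n * ((M : ℝ) ^ 3) ^ τ := by
    rw [Finset.sum_congr rfl fun i _ => by rw [(hcard i).1, (hcard i).2.1, (hcard i).2.2],
      sum_const, card_univ, Fintype.card_fin, nsmul_eq_mul]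
    push_cast
    ring_nf
  rwa [hsum]

/-- **The sharpest normal form of the crux: prime hosts, uniform blocks.** `AutomaticPackingThesis`
holds iff for every `τ > 2/3` some prime cyclic group `ℤ/q` hosts an STPP design all of whose
blocks have one size `M ≥ 2` and `q < n · (M³)^τ`. [folklore] -/
theorem automaticPackingThesis_iff_primeUniformBeat :
    AutomaticPackingThesis ↔
      ∀ τ : ℝ, 2 / 3 < τ → ∃ (q n M : ℕ) (_ : q.Prime) (_ : 2 ≤ M)
        (A B C : Fin n → Finset (ZMod q)),
        IsSTPP A B C ∧ (∀ i, (A i).card = M ∧ (B i).card = M ∧ (C i).card = M) ∧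
          (q : ℝ) < n * ((M : ℝ) ^ 3) ^ τ := by
  constructor
  · intro h τ hτ
    exact primeUniformBeat_of_cyclicBeat hτ (cyclicBeat_of_automaticPackingThesis h τ hτ)
  · intro h
    rw [automaticPackingThesis_iff_anyModulus]
    exact fun τ hτ => anyModulusBeat_of_primeUniformBeat (h τ hτ)

/-- Registered stub `stub_primeUniformNormalForm` of crux stmt-MatrixMultiplication-7356 (line
`Sketch`, lead c2): verbatim `automaticPackingThesis_iff_primeUniformBeat`. [folklore] -/
theorem stub_primeUniformNormalForm :
    AutomaticPackingThesis ↔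
      ∀ τ : ℝ, 2 / 3 < τ → ∃ (q n M : ℕ) (_ : q.Prime) (_ : 2 ≤ M)
        (A B C : Fin n → Finset (ZMod q)),
        IsSTPP A B C ∧ (∀ i, (A i).card = M ∧ (B i).card = M ∧ (C i).card = M) ∧
          (q : ℝ) < n * ((M : ℝ) ^ 3) ^ τ :=
  automaticPackingThesis_iff_primeUniformBeat

end AutomaticPackingThesis

end Summit.MatrixMultiplication.MatrixMultiplication.Theorems

end
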